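import Summits.Parity.GeneralizedHardyLittlewood.Theorems.GreenTaoLevelTwoMNTwoBoxPhase
import Summits.Parity.GeneralizedHardyLittlewood.Theorems.GreenTaoLevelTwoMNTwoQuadrilinearCount
import Summits.Parity.GeneralizedHardyLittlewood.Theorems.GreenTaoLevelTwoMNTwoTypeIIDenominator

/-!
# Route `GreenTaoLevelTwo`, crux `MNTwo` (stmt-Parity-21276), line `birth`, stub `stub_mnVertical`:
# the back half of Lemma 24: a large quadrilinear phase sum forces a denominator (GT 2008b §10)

Block V4 / H3 (= AIF §10 Lemma 24 "Type II sum implies major arc", from "(llm)" with the `b()`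
factors to the end of the proof) of the `stub_mnVertical` census (B. Green, T. Tao, *Quadratic
uniformity of the Möbius function*, Ann. Inst. Fourier 58 (2008) = arXiv:math/0606087, §10).
Def-free composition of the landed pieces `…MNTwoBoxPhase.norm_pow_sixteen_quadrilinear_le`
(box Cauchy–Schwarz), `…MNTwoQuadrilinearCount.many_small_triples` (pigeonhole + geometric sums)
and `…MNTwoTypeIIDenominator.typeII_denominator` (three rounds of Lemma 32 (ii)): if
`η n₁n₂n₃n₄ ≤ ‖∑ b₁b₂b₃b₄ e(c l₁l₂m₁m₂)‖` over four `ℤ`-intervals of sizes `nᵢ`, then — with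
`κ = η¹⁶` and under the explicit largeness conditions of `typeII_denominator` — some
`q ≤ Q(η)` has `‖qc‖_{ℝ/ℤ} ≤ C(η)/(n₄ n₃ n₂ n₁)` (polynomially in `1/η`).

* `quadrilinear_denominator` — the composition.

References: [GreenTao2008QuadraticMobius] arXiv:math/0606087 §10 (proof of Lemma 24).
-/

noncomputable section

open Finset
open scoped FourierTransform

namespace Summit.Parity.GeneralizedHardyLittlewood.GreenTaoLevelTwoMNTwoQuadrilinearDenominator

open Literature.NumberTheory.Sieve.Vinogradov (distInt)
open Summit.Parity.GeneralizedHardyLittlewood.GreenTaoLevelTwoMNTwoBoxPhase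
  (norm_pow_sixteen_quadrilinear_le)
open Summit.Parity.GeneralizedHardyLittlewood.GreenTaoLevelTwoMNTwoQuadrilinearCount
  (many_small_triples)
open Summit.Parity.GeneralizedHardyLittlewood.GreenTaoLevelTwoMNTwoTypeIIDenominator
  (typeII_denominator)

/-- **Lemma 24, back half.**  Four `ℤ`-intervals `[aᵢ,bᵢ]` of sizes `nᵢ = bᵢ − aᵢ + 1`,
`1`-bounded `b₁(l₂,m₁,m₂)`, `b₂(l₁,m₁,m₂)`, `b₃(l₁,l₂,m₂)`, `b₄(l₁,l₂,m₁)`, `0 < η ≤ 1`, and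
`η n₁n₂n₃n₄ ≤ ‖∑ b₁b₂b₃b₄ e(c l₁l₂m₁m₂)‖`.  With `κ = η¹⁶`, `N = n₄` and the auxiliary parameters
of `…MNTwoTypeIIDenominator.typeII_denominator` (fixed by the equations `hδ…`) and its largeness
conditions `H1–H6`, there is `1 ≤ q ≤ (25672/(κ/2)²)(25672/δB²)(25672/δC²)` with
`‖qc‖_{ℝ/ℤ} ≤ 2630455808·64·δ₁C/(δC⁶ n₁)`.
[cite: GreenTao2008QuadraticMobius, §10 (proof of Lemma 24)] -/
theorem quadrilinear_denominator (c : ℝ) {a₁ b₁ a₂ b₂ a₃ b₃ a₄ b₄ : ℤ} (h₁ : a₁ ≤ b₁)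
    (h₂ : a₂ ≤ b₂) (h₃ : a₃ ≤ b₃) (h₄ : a₄ ≤ b₄) (b₁' b₂' b₃' b₄' : ℤ → ℤ → ℤ → ℂ)
    (hb₁ : ∀ x y z, ‖b₁' x y z‖ ≤ 1) (hb₂ : ∀ x y z, ‖b₂' x y z‖ ≤ 1)
    (hb₃ : ∀ x y z, ‖b₃' x y z‖ ≤ 1) (hb₄ : ∀ x y z, ‖b₄' x y z‖ ≤ 1)
    {η κ δ₁A δB δ₁B δC δ₁C : ℝ} (hη : 0 < η) (hη1 : η ≤ 1) (hκ : κ = η ^ 16)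
    (hδ₁A : δ₁A = 1 / (κ * ((b₄ - a₄ + 1 : ℤ) : ℝ))) (hδB : δB = (κ / 2) ^ 3 / 51344)
    (hδ₁B : δ₁B = 2630455808 * 64 * δ₁A / ((κ / 2) ^ 6 * ((b₃ - a₃ + 1 : ℤ) : ℝ)))
    (hδC : δC = δB ^ 3 / 51344)
    (hδ₁C : δ₁C = 2630455808 * 64 * δ₁B / (δB ^ 6 * ((b₂ - a₂ + 1 : ℤ) : ℝ)))
    (H1 : δ₁A ≤ κ / 16) (H2 : 2 < (κ / 4) ^ 2 * ((b₃ - a₃ + 1 : ℤ) : ℝ))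
    (H3 : δ₁B ≤ δB / 8) (H4 : 2 < (δB / 2) ^ 2 * ((b₂ - a₂ + 1 : ℤ) : ℝ))
    (H5 : δ₁C ≤ δC / 8) (H6 : 2 < (δC / 2) ^ 2 * ((b₁ - a₁ + 1 : ℤ) : ℝ))
    (hlarge : η * ((b₁ - a₁ + 1 : ℤ) : ℝ) * ((b₂ - a₂ + 1 : ℤ) : ℝ) * ((b₃ - a₃ + 1 : ℤ) : ℝ) *
        ((b₄ - a₄ + 1 : ℤ) : ℝ) ≤
      ‖∑ l₁ ∈ Icc a₁ b₁, ∑ l₂ ∈ Icc a₂ b₂, ∑ m₁ ∈ Icc a₃ b₃, ∑ m₂ ∈ Icc a₄ b₄,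
        b₁' l₂ m₁ m₂ * b₂' l₁ m₁ m₂ * b₃' l₁ l₂ m₂ * b₄' l₁ l₂ m₁ *
          (𝐞 (c * l₁ * l₂ * m₁ * m₂) : ℂ)‖) :
    ∃ q : ℕ, 1 ≤ q ∧
      (q : ℝ) ≤ (25672 / (κ / 2) ^ 2) * (25672 / δB ^ 2) * (25672 / δC ^ 2) ∧
      distInt (q * c) ≤ 2630455808 * 64 * δ₁C / (δC ^ 6 * ((b₁ - a₁ + 1 : ℤ) : ℝ)) := by
  classical
  -- sizes
  have hn : ∀ {a b : ℤ}, a ≤ b → (#(Icc a b) : ℝ) = ((b - a + 1 : ℤ) : ℝ) := by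
    intro a b hab
    rw [Int.card_Icc]
    have : (((b + 1 - a).toNat : ℕ) : ℤ) = b - a + 1 := by
      rw [Int.toNat_of_nonneg (by omega)]; ring
    exact_mod_cast this
  have hn₁ := hn h₁
  have hn₂ := hn h₂
  have hn₃ := hn h₃
  have hn₄ := hn h₄
  have hpos : ∀ {a b : ℤ}, a ≤ b → (0 : ℝ) < ((b - a + 1 : ℤ) : ℝ) := by
    intro a b hab
    have : (0 : ℤ) < b - a + 1 := by omega
    exact_mod_cast this
  have hn₁p := hpos h₁
  have hn₂p := hpos h₂
  have hn₃p := hpos h₃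
  have hn₄p := hpos h₄
  have hκ0 : 0 < κ := by rw [hκ]; positivity
  have hκ1 : κ ≤ 1 := by rw [hκ]; exact pow_le_one₀ hη.le hη1
  -- Step 1: box Cauchy–Schwarz
  have hbox := norm_pow_sixteen_quadrilinear_le (Icc a₁ b₁) (Icc a₂ b₂) (Icc a₃ b₃) (Icc a₄ b₄) c
    b₁' b₂' b₃' b₄' hb₁ hb₂ hb₃ hb₄
  rw [hn₁, hn₂, hn₃, hn₄] at hbox
  set P : ℝ := ((b₁ - a₁ + 1 : ℤ) : ℝ) * ((b₂ - a₂ + 1 : ℤ) : ℝ) * ((b₃ - a₃ + 1 : ℤ) : ℝ) *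
    ((b₄ - a₄ + 1 : ℤ) : ℝ) with hP
  have hPpos : 0 < P := by rw [hP]; positivity
  have hRe : κ * ((#(Icc a₁ b₁) : ℝ)) ^ 2 * ((#(Icc a₂ b₂) : ℝ)) ^ 2 * ((#(Icc a₃ b₃) : ℝ)) ^ 2 *
      ((#(Icc a₄ b₄) : ℝ)) ^ 2 ≤
      (∑ l₁ ∈ Icc a₁ b₁, ∑ l₁' ∈ Icc a₁ b₁, ∑ l₂ ∈ Icc a₂ b₂, ∑ l₂' ∈ Icc a₂ b₂,
        ∑ m₁ ∈ Icc a₃ b₃, ∑ m₁' ∈ Icc a₃ b₃, ∑ m₂ ∈ Icc a₄ b₄, ∑ m₂' ∈ Icc a₄ b₄,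
          (𝐞 (c * (l₁ - l₁') * (l₂ - l₂') * (m₁ - m₁') * (m₂ - m₂')) : ℂ)).re := by
    rw [hn₁, hn₂, hn₃, hn₄]
    -- `(η P)¹⁶ ≤ ‖Σ‖¹⁶ ≤ P¹⁴ Re Σ₈`
    have h16 : (η * P) ^ 16 ≤ P ^ 14 * (∑ l₁ ∈ Icc a₁ b₁, ∑ l₁' ∈ Icc a₁ b₁, ∑ l₂ ∈ Icc a₂ b₂,
        ∑ l₂' ∈ Icc a₂ b₂, ∑ m₁ ∈ Icc a₃ b₃, ∑ m₁' ∈ Icc a₃ b₃, ∑ m₂ ∈ Icc a₄ b₄,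
          ∑ m₂' ∈ Icc a₄ b₄,
            (𝐞 (c * (l₁ - l₁') * (l₂ - l₂') * (m₁ - m₁') * (m₂ - m₂')) : ℂ)).re := by
      have hl : η * P ≤ ‖∑ l₁ ∈ Icc a₁ b₁, ∑ l₂ ∈ Icc a₂ b₂, ∑ m₁ ∈ Icc a₃ b₃, ∑ m₂ ∈ Icc a₄ b₄,
          b₁' l₂ m₁ m₂ * b₂' l₁ m₁ m₂ * b₃' l₁ l₂ m₂ * b₄' l₁ l₂ m₁ *
            (𝐞 (c * l₁ * l₂ * m₁ * m₂) : ℂ)‖ := by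
        rw [hP]; refine (le_of_eq (by ring)).trans hlarge
      refine (pow_le_pow_left₀ (by positivity) hl 16).trans ?_
      rw [hP]
      refine hbox.trans (le_of_eq ?_)
      ring
    -- divide by `P¹⁴`
    have e : κ * ((b₁ - a₁ + 1 : ℤ) : ℝ) ^ 2 * ((b₂ - a₂ + 1 : ℤ) : ℝ) ^ 2 *
        ((b₃ - a₃ + 1 : ℤ) : ℝ) ^ 2 * ((b₄ - a₄ + 1 : ℤ) : ℝ) ^ 2 = (η * P) ^ 16 / P ^ 14 := by
      rw [hκ, hP]
      field_simp
    rw [e, div_le_iff₀ (by positivity)]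
    linarith [h16]
  -- Step 2: many small triples
  have hS₁ : (Icc a₁ b₁).Nonempty := ⟨a₁, by rw [Finset.mem_Icc]; exact ⟨le_rfl, h₁⟩⟩
  have hS₂ : (Icc a₂ b₂).Nonempty := ⟨a₂, by rw [Finset.mem_Icc]; exact ⟨le_rfl, h₂⟩⟩
  have hS₃ : (Icc a₃ b₃).Nonempty := ⟨a₃, by rw [Finset.mem_Icc]; exact ⟨le_rfl, h₃⟩⟩
  obtain ⟨l₁', -, l₂', -, m₁', -, hcount⟩ := many_small_triples h₄ c hκ0 hS₁ hS₂ hS₃ hRe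
  rw [hn₁, hn₂, hn₃, hn₄] at hcount
  -- Step 3: three rounds of Lemma 32 (ii)
  exact typeII_denominator c h₁ h₂ h₃ l₁' l₂' m₁' hκ0 hκ1 hn₄p hδ₁A hδB hδ₁B hδC hδ₁C H1 H2 H3
    H4 H5 H6 hcount

end Summit.Parity.GeneralizedHardyLittlewood.GreenTaoLevelTwoMNTwoQuadrilinearDenominator
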